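import Summits.FinalStateConjecture.FinalStateConjecture.Theorems.ClusterCompletenessAdiabaticMultiKerrILEDField

/-!
# Route ClusterCompleteness — crux `AdiabaticMultiKerrILED`, line `Sketch`: uniform gradient bound
# for one tails-cut boosted Kerr–Schild term

Helper file for the crux `stmt-FinalStateConjecture-14310`
(`Summit.FinalStateConjecture.FinalStateConjecture.Theses.ClusterCompleteness.AdiabaticMultiKerrILED`),
closing the stub `stub_termDerivBound` of line `Sketch`.

The patched inverse metric of the crux is `G = η − Σᵢ termᵢ` with
`termᵢ(y) = χ(rᵢ(qᵢ y)) · 2Hᵢ(qᵢ y) · (Λᵢℓ♯ᵢ(qᵢ y))^α (Λᵢℓ♯ᵢ(qᵢ y))^β`, `χ(r) = smoothTransition (2 − r/8M)`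
(`= 0` for `r ≥ 16M`), `qᵢ = poincareInv Λᵢ (0, pᵢ)` the affine map to the rest frame. The finite-time
energy estimate (Grönwall) needs a bound on the first coordinate derivatives of each term which is
UNIFORM over the whole lab region `{r₊/2 < r ∘ q}` (all times). Proof: write `term = g ∘ q` with the
rest-frame function `g(z) = χ(r(z)) 2H(z) (Λℓ♯(z))^α (Λℓ♯(z))^β`; then `D term(x) = Dg(q x) ∘ Λ⁻¹`
(chain rule, `Dq = Λ⁻¹`), so `|∂_μ term(x)| ≤ ‖Dg(q x)‖ ‖Λ⁻¹‖`. The Kerr–Schild data are stationary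
(`r`, `H`, `ℓ♯` are invariant under `z ↦ z + t e₀`: `Kerr.radius_add_time_smul_basisVector`,
`Kerr.scalarH_add_smul_basisVector_zero`, `Kerr.nullVector_add_smul_basisVector_zero`), hence so is
`Dg`, and its values on `{r₊/2 ≤ r}` are its values on the time-zero shell
`K = {z⁰ = 0, r₊/2 ≤ r(z) ≤ 16M}` together with `0` on `{16M < r}` (where `g ≡ 0` locally). `K` is
closed and bounded (`‖z‖² = ‖z⃗‖² ≤ r² + a²`), hence compact, and `Dg` is continuous on `K` (`g` is `C¹`
off the ring `{r = 0}`: `Kerr.contDiffAt_radius_comp` etc.), so `‖Dg‖` is bounded there. Standard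
calculus (chain rule, continuity on compacta); Kerr–Schild 1965, §2 (stationarity); Visser
arXiv:0706.0622, (33)–(35). [folklore]
-/

noncomputable section

-- the doubled `FinalStateConjecture.FinalStateConjecture` path component trips dupNamespace
set_option linter.dupNamespace false

open scoped ContDiff Topology
open Filter Set Literature.Geometry.Lorentzian

namespace Summit.FinalStateConjecture.FinalStateConjecture.Cruxes.AdiabaticMultiKerrILED.Sketch

/-! ### Stationary functions off the Kerr ring: a uniform gradient bound -/

/-- **Uniform gradient bound for a stationary function.** If `g : ℝ⁴ → ℝ` is invariant under the time
translations `z ↦ z + t e₀`, is `C¹` off the ring `{r_a = 0}`, and has vanishing derivative on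
`{R < r_a}`, then `‖Dg‖` is bounded on `{ρ₀ ≤ r_a}` for every `ρ₀ > 0`: `Dg` is also time-translation
invariant (`fderiv_comp_add_right`), so its values there are values on the compact time-zero shell
`{z⁰ = 0, ρ₀ ≤ r_a ≤ R}` (closed, and bounded by `‖z⃗‖² ≤ r² + a²`,
`Kerr.spatialNorm_sq_sub_sq_le_radius_sq`), where it is continuous, or `0`. [folklore] -/
private theorem exists_bound_fderiv_of_stationary {a ρ₀ R : ℝ} (hρ : 0 < ρ₀) {g : E4 → ℝ}
    (hinv : ∀ (z : E4) (t : ℝ), g (z + t • E4.basisVector 0) = g z)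
    (hdiff : ∀ z : E4, 0 < Kerr.radius a z → ContDiffAt ℝ 1 g z)
    (hfar : ∀ z : E4, R < Kerr.radius a z → fderiv ℝ g z = 0) :
    ∃ D₀ : ℝ, 0 ≤ D₀ ∧ ∀ z : E4, ρ₀ ≤ Kerr.radius a z → ‖fderiv ℝ g z‖ ≤ D₀ := by
  -- the time-zero shell
  set K : Set E4 := {z | z 0 = 0 ∧ ρ₀ ≤ Kerr.radius a z ∧ Kerr.radius a z ≤ R} with hK
  have hKc : IsCompact K := by
    refine Metric.isCompact_of_isClosed_isBounded ?_ ?_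
    · exact (isClosed_eq (Kerr.contDiff_coord (n := 0) 0).continuous continuous_const).inter
        ((isClosed_le continuous_const (Kerr.continuous_radius a)).inter
          (isClosed_le (Kerr.continuous_radius a) continuous_const))
    · refine (Metric.isBounded_closedBall (x := (0 : E4)) (r := √(R ^ 2 + a ^ 2))).subset ?_
      rintro z ⟨hz0, -, hzR⟩
      rw [Metric.mem_closedBall, dist_zero_right]
      have h1 : ‖z‖ ^ 2 = E4.spatialNorm z ^ 2 := by
        rw [EuclideanSpace.real_norm_sq_eq, E4.spatialNorm_sq, Fin.sum_univ_four]
        have : z 0 ^ 2 = 0 := by rw [hz0]; ring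
        linarith
      have h2 := Kerr.spatialNorm_sq_sub_sq_le_radius_sq a z
      have h3 : Kerr.radius a z ^ 2 ≤ R ^ 2 := pow_le_pow_left₀ (Kerr.radius_nonneg a z) hzR 2
      refine (Real.le_sqrt (norm_nonneg z) (by positivity)).mpr ?_
      linarith
  -- `Dg` is continuous on the shell (`r ≥ ρ₀ > 0` there)
  have hcont : ContinuousOn (fderiv ℝ g) K := fun z hz ↦
    ((hdiff z (hρ.trans_le hz.2.1)).continuousAt_fderiv one_ne_zero).continuousWithinAt
  obtain ⟨C, hC⟩ := hKc.exists_bound_of_continuousOn hcont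
  refine ⟨max C 0, le_max_right _ _, fun z hz ↦ ?_⟩
  by_cases hR : Kerr.radius a z ≤ R
  · -- translate to the time-zero slice
    have hshift : fderiv ℝ g (z + (-z 0) • E4.basisVector 0) = fderiv ℝ g z := by
      have hfun : (fun w ↦ g (w + (-z 0) • E4.basisVector 0)) = g := funext fun w ↦ hinv w _
      rw [← fderiv_comp_add_right, hfun]
    rw [← hshift]
    refine (hC _ ⟨by simp, ?_, ?_⟩).trans (le_max_left _ _)
    · rwa [Kerr.radius_add_time_smul_basisVector]
    · rwa [Kerr.radius_add_time_smul_basisVector]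
  · rw [hfar z (not_le.mp hR), norm_zero]
    exact le_max_right _ _

/-! ### Chain rule through the rest-frame map -/

/-- The inverse Poincaré map `y ↦ Λ⁻¹(y − c)` is affine with derivative `Λ⁻¹` (O'Neill 1983, Ch. 9,
p. 236; cf. `KerrSchildChart.hasFDerivAt_poincareInv`). [folklore] -/
private theorem hasFDerivAt_poincareInv' (Λ : lorentzGroup) (c y : E4) :
    HasFDerivAt (poincareInv Λ c) ((Λ : E4 ≃L[ℝ] E4).symm : E4 →L[ℝ] E4) y := by
  have h : HasFDerivAt (fun x : E4 ↦ x - c) (ContinuousLinearMap.id ℝ E4) y :=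
    (hasFDerivAt_id y).sub_const c
  have h2 := ((Λ : E4 ≃L[ℝ] E4).symm : E4 →L[ℝ] E4).hasFDerivAt.comp y h
  rwa [ContinuousLinearMap.comp_id] at h2

/-- `‖∂_μ‖ = 1` in `E4` (cf. `norm_basisVector` of the far-pointwise file). [folklore] -/
private theorem norm_basisVector' (μ : Fin 4) : ‖E4.basisVector μ‖ = 1 := by
  simp [E4.basisVector]

/-- **Chain rule through the rest-frame map**: if `g` is differentiable at `q x`
(`q = poincareInv Λ c`, `Dq = Λ⁻¹`) with `‖Dg(q x)‖ ≤ D₀`, then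
`|∂_μ (g ∘ q)(x)| = |Dg(q x) (Λ⁻¹ ∂_μ)| ≤ D₀ ‖Λ⁻¹‖`. [folklore] -/
private theorem abs_fderiv_comp_poincareInv_apply_le {g : E4 → ℝ} {Λ : lorentzGroup} {c x : E4}
    {D₀ : ℝ} (hg : DifferentiableAt ℝ g (poincareInv Λ c x))
    (hD : ‖fderiv ℝ g (poincareInv Λ c x)‖ ≤ D₀) (μ : Fin 4) :
    |fderiv ℝ (fun y ↦ g (poincareInv Λ c y)) x (E4.basisVector μ)| ≤
      D₀ * ‖((Λ : E4 ≃L[ℝ] E4).symm : E4 →L[ℝ] E4)‖ := by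
  have key : HasFDerivAt (fun y ↦ g (poincareInv Λ c y))
      ((fderiv ℝ g (poincareInv Λ c x)).comp ((Λ : E4 ≃L[ℝ] E4).symm : E4 →L[ℝ] E4)) x :=
    hg.hasFDerivAt.comp x (hasFDerivAt_poincareInv' Λ c x)
  rw [key.fderiv, ContinuousLinearMap.comp_apply, ← Real.norm_eq_abs]
  calc ‖fderiv ℝ g (poincareInv Λ c x) (((Λ : E4 ≃L[ℝ] E4).symm : E4 →L[ℝ] E4) (E4.basisVector μ))‖
      ≤ ‖fderiv ℝ g (poincareInv Λ c x)‖ *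
          ‖((Λ : E4 ≃L[ℝ] E4).symm : E4 →L[ℝ] E4) (E4.basisVector μ)‖ :=
        ContinuousLinearMap.le_opNorm _ _
    _ ≤ ‖fderiv ℝ g (poincareInv Λ c x)‖ *
          (‖((Λ : E4 ≃L[ℝ] E4).symm : E4 →L[ℝ] E4)‖ * ‖E4.basisVector μ‖) := by
        gcongr
        exact ContinuousLinearMap.le_opNorm _ _
    _ ≤ D₀ * (‖((Λ : E4 ≃L[ℝ] E4).symm : E4 →L[ℝ] E4)‖ * ‖E4.basisVector μ‖) := by gcongr
    _ = D₀ * ‖((Λ : E4 ≃L[ℝ] E4).symm : E4 →L[ℝ] E4)‖ := by rw [norm_basisVector', mul_one]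

/-! ### The rest-frame term -/

/-- **The rest-frame term and its uniform gradient bound.** The rest-frame Kerr–Schild term
`g_{αβ}(z) = χ(r(z)) · 2H(z) · (Λℓ♯(z))^α (Λℓ♯(z))^β` of the patched field is stationary (invariant under
`z ↦ z + t e₀`; Kerr–Schild 1965, §2), `C¹` off the ring `{r = 0}` (`r`, `H`, `ℓ♯` real-analytic there,
`smoothTransition` smooth; cf. `Theorems.contDiffAt_cruxTerm`), and locally `0` on the open set
`{16M < r}` (`Theorems.cruxCutoff_eq_zero`); hence (`exists_bound_fderiv_of_stationary`, `r₊ ≥ M > 0`)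
it is differentiable with `‖Dg_{αβ}‖ ≤ D₁` on `{r₊/2 ≤ r}`, one constant for all `α, β`. [folklore] -/
private theorem exists_bound_fderiv_restTerm {M : ℝ} (hM : 0 < M) (a : ℝ) (Λ : lorentzGroup)
    {g : Fin 4 → Fin 4 → E4 → ℝ}
    (hg : g = fun α β z ↦ Real.smoothTransition (2 - Kerr.radius a z / (8 * M)) *
      (2 * Kerr.scalarH M a z) * ((Λ : E4 ≃L[ℝ] E4) (Kerr.nullVector a z)) α *
      ((Λ : E4 ≃L[ℝ] E4) (Kerr.nullVector a z)) β) :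
    ∃ D₁ : ℝ, 0 ≤ D₁ ∧ ∀ (α β : Fin 4) (z : E4), 2⁻¹ * Kerr.rPlus M a ≤ Kerr.radius a z →
      DifferentiableAt ℝ (g α β) z ∧ ‖fderiv ℝ (g α β) z‖ ≤ D₁ := by
  -- `r₊ = M + √(M² − a²) > 0`
  have hρ : 0 < 2⁻¹ * Kerr.rPlus M a := by
    have : 0 < Kerr.rPlus M a := by unfold Kerr.rPlus; positivity
    positivity
  -- stationarity
  have hinv : ∀ (α β : Fin 4) (z : E4) (t : ℝ), g α β (z + t • E4.basisVector 0) = g α β z := by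
    intro α β z t
    simp only [hg, Kerr.radius_add_time_smul_basisVector, Kerr.scalarH_add_smul_basisVector_zero,
      Kerr.nullVector_add_smul_basisVector_zero]
  -- smoothness off the ring
  have hdiff : ∀ (α β : Fin 4) (z : E4), 0 < Kerr.radius a z → ContDiffAt ℝ 1 (g α β) z := by
    intro α β z hz
    have hq : ContDiffAt ℝ 1 (fun y : E4 ↦ y) z := contDiffAt_id
    have hr : ContDiffAt ℝ 1 (fun y ↦ Kerr.radius a y) z :=
      Kerr.contDiffAt_radius_comp contDiffAt_const hq hz
    have hH : ContDiffAt ℝ 1 (fun y ↦ Kerr.scalarH M a y) z :=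
      Kerr.contDiffAt_scalarH_comp contDiffAt_const contDiffAt_const hq hz
    have hl : ContDiffAt ℝ 1 (fun y ↦ Kerr.nullVector a y) z :=
      Kerr.contDiffAt_nullVector_comp contDiffAt_const hq hz
    have hΛl : ContDiffAt ℝ 1 (fun y ↦ (Λ : E4 ≃L[ℝ] E4) (Kerr.nullVector a y)) z :=
      ((Λ : E4 ≃L[ℝ] E4) : E4 →L[ℝ] E4).contDiff.contDiffAt.comp z hl
    have hcomp : ∀ κ : Fin 4,
        ContDiffAt ℝ 1 (fun y ↦ ((Λ : E4 ≃L[ℝ] E4) (Kerr.nullVector a y)) κ) z :=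
      contDiffAt_euclidean.mp hΛl
    have hχ : ContDiffAt ℝ 1 (fun y ↦ Real.smoothTransition (2 - Kerr.radius a y / (8 * M))) z :=
      (Real.smoothTransition.contDiff (n := 1)).contDiffAt.comp z
        (contDiffAt_const.sub (hr.div_const _))
    rw [hg]
    exact ((hχ.mul (contDiffAt_const.mul hH)).mul (hcomp α)).mul (hcomp β)
  -- tails cut: `g ≡ 0` on the open set `{16M < r}`
  have hfar : ∀ (α β : Fin 4) (z : E4), 16 * M < Kerr.radius a z → fderiv ℝ (g α β) z = 0 := by
    intro α β z hz
    have hopen : IsOpen {w : E4 | 16 * M < Kerr.radius a w} :=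
      isOpen_lt continuous_const (Kerr.continuous_radius a)
    have hev : g α β =ᶠ[𝓝 z] fun _ ↦ (0 : ℝ) := by
      filter_upwards [hopen.mem_nhds hz] with w hw
      simp only [hg, Theorems.cruxCutoff_eq_zero hM (le_of_lt hw), zero_mul]
    rw [hev.fderiv_eq, fderiv_fun_const, Pi.zero_apply]
  -- the uniform bound, component by component, then summed over the `16` components
  have hD : ∀ α β : Fin 4, ∃ D₀ : ℝ, 0 ≤ D₀ ∧ ∀ z : E4, 2⁻¹ * Kerr.rPlus M a ≤ Kerr.radius a z →
      ‖fderiv ℝ (g α β) z‖ ≤ D₀ := fun α β ↦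
    exists_bound_fderiv_of_stationary hρ (hinv α β) (hdiff α β) (hfar α β)
  choose D₀ hD₀ hD using hD
  refine ⟨∑ α, ∑ β, D₀ α β, Finset.sum_nonneg fun α _ ↦ Finset.sum_nonneg fun β _ ↦ hD₀ α β,
    fun α β z hz ↦ ⟨((hdiff α β z (hρ.trans_le hz)).differentiableAt one_ne_zero), ?_⟩⟩
  have hle1 : D₀ α β ≤ ∑ β', D₀ α β' :=
    Finset.single_le_sum (f := fun β' ↦ D₀ α β') (fun β' _ ↦ hD₀ α β') (Finset.mem_univ β)
  have hle2 : ∑ β', D₀ α β' ≤ ∑ α', ∑ β', D₀ α' β' :=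
    Finset.single_le_sum (f := fun α' ↦ ∑ β', D₀ α' β')
      (fun α' _ ↦ Finset.sum_nonneg fun β' _ ↦ hD₀ α' β') (Finset.mem_univ α)
  exact (hD α β z hz).trans (hle1.trans hle2)

/-! ### The stub -/

/-- **Uniform bound on the first derivatives of one tails-cut boosted Kerr–Schild term.** For a hole
`(M, a, Λ, p)` with `M > 0` and rest-frame map `q = poincareInv Λ (0, p)`, the lab-frame coordinate
derivatives `∂_μ [χ(r(q y)) · 2H(q y) · (Λℓ♯(q y))^α (Λℓ♯(q y))^β]` are bounded by one constant `D` on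
the whole region `{r₊/2 < r ∘ q}` (all times): the term is `g ∘ q` with `g` stationary, `C¹` off the
ring and locally `0` on `{16M < r}`, `Dq = Λ⁻¹`, and `Dg` is bounded on `{r₊/2 ≤ r}` by stationarity and
compactness of the time-zero shell (`exists_bound_fderiv_restTerm`), so `|∂_μ (g ∘ q)| ≤ D₁ ‖Λ⁻¹‖`.
Chain rule and continuity on compacta; Kerr–Schild 1965, §2; Visser arXiv:0706.0622, (33)–(35).
[folklore] -/
theorem stub_termDerivBound :
    ∀ (M a : ℝ) (Λ : lorentzGroup) (p : E3) (q : E4 → E4),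
      (∀ x, q x = poincareInv Λ (E4.ofTimeSpace 0 p) x) → 0 < M → |a| ≤ 2⁻¹ * M →
      ∃ D : ℝ, 0 ≤ D ∧ ∀ x : E4, 2⁻¹ * Kerr.rPlus M a < Kerr.radius a (q x) → ∀ μ α β : Fin 4,
        |fderiv ℝ (fun y ↦ Real.smoothTransition (2 - Kerr.radius a (q y) / (8 * M)) *
            (2 * Kerr.scalarH M a (q y)) * ((Λ : E4 ≃L[ℝ] E4) (Kerr.nullVector a (q y))) α *
            ((Λ : E4 ≃L[ℝ] E4) (Kerr.nullVector a (q y))) β) x (E4.basisVector μ)| ≤ D := by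
  intro M a Λ p q hq hM _
  obtain rfl : q = poincareInv Λ (E4.ofTimeSpace 0 p) := funext hq
  obtain ⟨D₁, hD₁, hD⟩ := exists_bound_fderiv_restTerm hM a Λ rfl
  refine ⟨D₁ * ‖((Λ : E4 ≃L[ℝ] E4).symm : E4 →L[ℝ] E4)‖, mul_nonneg hD₁ (norm_nonneg _),
    fun x hx μ α β ↦ ?_⟩
  obtain ⟨hdg, hbd⟩ := hD α β _ hx.le
  exact abs_fderiv_comp_poincareInv_apply_le hdg hbd μ

end Summit.FinalStateConjecture.FinalStateConjecture.Cruxes.AdiabaticMultiKerrILED.Sketch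

end
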